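import Summits.CriticalPhenomena.PercolationContinuityZ3.Theorems.Transplant.SkelHabChainT
import Summits.CriticalPhenomena.PercolationContinuityZ3.Theorems.Transplant.SkelKitResiduesHab
import Summits.CriticalPhenomena.PercolationContinuityZ3.Theorems.Transplant.SkelConcRoot
import Summits.CriticalPhenomena.PercolationContinuityZ3.Theorems.Transplant.SkelTubeSub
import HarnessLib

/-!
# L6 (C), packaging over the habitat: the CORRIDOR RESIDUE `Skel.ReachOblAtH` (stmt-g7, `SkelKitResiduesHab`) for the concentric scheme of
# record `⟨Skel.cellGeomSG Φ C t Λ, q, δc⟩` at one chosen valid probe `(h, e)`, departure anchor `a'` and onward direction `du`, from a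
# HABITAT CHAIN `P : Skel.HabChainData V` (`SkelHabChainT`) whose window graph is the FRESH HABITAT ITSELF,
# **`Ω := E^{α}_{x,y} ∪ H^{a'}_{y,y+du}`** (spans; `α = aOf₁`; p3-g4's ruling 20:22:53Z on SHEAR-SCOPE §2.6 — the explored region `Vx` is left
# out of `Ω` so that every chain region is fresh by `disjoint_Vx_of_fresh`, nothing else changes) — generic twin of p2-g2's
# `KNCellsBoxProdZ2ConcReach` (`reachOblAt_concG`), where the product tube `B_X(w₀,E) × ·` played the part of `Ω`

builds on p205010 (kernel theorem, internal audit signed; external expert review pending) — nothing in this file uses p205010.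
Status sentence (coordinator 2026-08-20T04:30Z): "θ(p_c) = 0 on ℤ^d, all d ≥ 2 — kernel-verified (Lean 4/Mathlib, standard axioms); internal
adversarial audit SIGNED 2026-08-20 04:29Z; external expert review pending."
Lane `prim-bschramm-*`, seat `prim-bschramm-p2` (gen 4); helper file (`--supports stmt-CriticalPhenomena-4575`).

WHY NO RADIUS (IN)EQUALITY IS NEEDED FOR THE SUBBOX PROPERTY: with `Ω` the fresh habitat, `IsSubbox (winGraphIn G Ω) Wcor q D` for
`D := Ω ∩ φ⁻¹(region)` has `adj` because `D ⊆ Ω ⊆ Ucor ∩ Sx` by definition, and `outside` because a `Ucor`-vertex adjacent to a fresh vertex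
lies in `E_{x,y} ∪ H` (`mem_of_adj_fresh`) `= Ω`, hence is `winGraphIn`-adjacent (`isSubbox_Wcor_hab`).  What the schedule must still supply
is only DEPTH ROOM: (i) every planar core has a vertex of `Ω` above it — column depth `20r‖y‖₁ + 44r + 1 ≤ rQ_α(y)` and `≤ ρ_{a'}(y,du)(ℓ)`
for all `ℓ` (targets nonempty); (ii) the last target enters `M^{a'}_{y+du}` by the step device — `ρ_{a'}(y,du)(ℓ) + 1 ≤ rM_{a'}(y+du)`.
The arrival cube needs nothing (`M_α(y) ⊆ Q_α(y)`, `ExitGeom`).  The per-step kit clauses, the rim excess and the count stay hypotheses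
(p5-g4's `SkelConcReachRun`, the L5.15 kits).
* `PCells.norm_le_of_mem_Q_union_Hfull` (planar: `‖x₀‖₁ ≤ 20r‖y‖₁ + 44r` on `C.Q y ∪ C.Hfull y du`), `PCells.BtwN_disjoint_Q_union_Hfull`;
* `PlanarSkeletonConc.mem_VStair_of_zdAdj` (the step device into a staircase span);
* **`Skel.isSubbox_Wcor_hab`** (any lag-1 anchored scheme); `Skel.habΩ` (the fresh habitat) and its three containments;
* **`Skel.reachOblAtH_concSG`**.
[cite: KozmaNitzan2024, §4 Lemma 12 (pp. 23–25), p. 26 (M_x, H_{v,x}), p. 30 (Step IV), p. 31]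
-/

noncomputable section

open MeasureTheory ProbabilityTheory
open scoped ENNReal Classical

namespace Summit.CriticalPhenomena.PercolationContinuityZ3.Theorems

namespace Transplant

/-! ## §0 Planar supplements -/

namespace PCells

open Literature.Probability.Percolation Literature.Probability.LatticeModels SimpleGraph Contour
open Literature.Probability.Percolation.KozmaNitzan
open Literature.Probability.Percolation.KozmaNitzan.Cells (oth oth_ne eq_oth_of_ne sgOf sgOf_sign stepVec_apply_fst stepVec_apply_oth)

/-- A point of `C.Q y ∪ C.Hfull y du` is within `22r` of `cen y` in each coordinate. [folklore] -/
theorem abs_sub_cen_le_of_mem_Q_union_Hfull (C : PCells) (y : Site 2) (du : MDir) {x₀ : Site 2} (hx : x₀ ∈ C.Q y ∪ C.Hfull y du)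
    (i : Fin 2) : |x₀ i - C.cen y i| ≤ 22 * (C.r : ℤ) := by
  have hr : (0 : ℤ) ≤ C.r := by positivity
  rcases Finset.mem_union.1 hx with h | h
  · rw [PCells.Q, C.mem_sq_iff] at h
    have := h i
    push_cast at this
    rw [abs_le]; constructor <;> linarith
  · rw [PCells.Hfull, mem_psBox_iff] at h
    obtain ⟨⟨h1, h2⟩, h3, h4⟩ := h
    by_cases hi : i = du.1
    · subst hi
      rcases sgOf_sign du with hs | hs <;> rw [hs] at h1 h2 <;> rw [abs_le] <;> constructor <;> linarith
    · rw [eq_oth_of_ne hi, abs_le]; constructor <;> linarith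

/-- **Column depth bound**: a point of `C.Q y ∪ C.Hfull y du` has ℓ¹-norm `≤ 20r‖y‖₁ + 44r`. [folklore] -/
theorem norm_le_of_mem_Q_union_Hfull (C : PCells) (y : Site 2) (du : MDir) {x₀ : Site 2} (hx : x₀ ∈ C.Q y ∪ C.Hfull y du) :
    (x₀ 0).natAbs + (x₀ 1).natAbs ≤ 20 * C.r * ((y 0).natAbs + (y 1).natAbs) + 44 * C.r := by
  have h0 := C.abs_sub_cen_le_of_mem_Q_union_Hfull y du hx 0
  have h1 := C.abs_sub_cen_le_of_mem_Q_union_Hfull y du hx 1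
  simp only [PCells.cen_apply] at h0 h1
  have e0 : ((x₀ 0).natAbs : ℤ) = |x₀ 0| := Int.natCast_natAbs _
  have e1 : ((x₀ 1).natAbs : ℤ) = |x₀ 1| := Int.natCast_natAbs _
  have f0 : ((y 0).natAbs : ℤ) = |y 0| := Int.natCast_natAbs _
  have f1 : ((y 1).natAbs : ℤ) = |y 1| := Int.natCast_natAbs _
  have hr : (0 : ℤ) ≤ C.r := by positivity
  have k0 : |x₀ 0| ≤ 20 * (C.r : ℤ) * |y 0| + 22 * C.r := by
    calc |x₀ 0| = |(x₀ 0 - 20 * (C.r : ℤ) * y 0) + 20 * (C.r : ℤ) * y 0| := by ring_nf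
      _ ≤ |x₀ 0 - 20 * (C.r : ℤ) * y 0| + |20 * (C.r : ℤ) * y 0| := abs_add_le _ _
      _ ≤ 22 * C.r + 20 * (C.r : ℤ) * |y 0| := by rw [abs_mul, abs_of_nonneg (by positivity : (0:ℤ) ≤ 20 * C.r)]; linarith
      _ = _ := by ring
  have k1 : |x₀ 1| ≤ 20 * (C.r : ℤ) * |y 1| + 22 * C.r := by
    calc |x₀ 1| = |(x₀ 1 - 20 * (C.r : ℤ) * y 1) + 20 * (C.r : ℤ) * y 1| := by ring_nf
      _ ≤ |x₀ 1 - 20 * (C.r : ℤ) * y 1| + |20 * (C.r : ℤ) * y 1| := abs_add_le _ _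
      _ ≤ 22 * C.r + 20 * (C.r : ℤ) * |y 1| := by rw [abs_mul, abs_of_nonneg (by positivity : (0:ℤ) ≤ 20 * C.r)]; linarith
      _ = _ := by ring
  have : ((x₀ 0).natAbs : ℤ) + (x₀ 1).natAbs ≤ 20 * C.r * (((y 0).natAbs : ℤ) + (y 1).natAbs) + 44 * C.r := by
    rw [e0, e1, f0, f1]; nlinarith
  exact_mod_cast this

/-- Self-adjacency of the full corridor `H_{v,x}` (transverse side `4r ≥ 1`). [folklore] -/
theorem exists_adj_of_mem_Hfull (C : PCells) (v : Site 2) (δ : MDir) {t : Site 2} (ht : t ∈ C.Hfull v δ) :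
    ∃ t' ∈ C.Hfull v δ, (zdGraph 2).Adj t t' := by
  unfold PCells.Hfull sBox at ht ⊢
  refine PCells.exists_adj_of_mem_Icc (oth δ.1) ?_ ht
  simp only [sLo, sHi, if_neg (oth_ne δ.1)]
  have := C.one_le_r; omega

/-- **The incoming between-box misses the cube and the onward corridor of the target**: `BtwN x δ ∩ (Q y ∪ H_{y,du}) = ∅` for `y = x + δ`,
`du ≠ rev δ`. [cite: KozmaNitzan2024, §4 p. 26 (Figure 3)] -/
theorem BtwN_disjoint_Q_union_Hfull (C : PCells) (x : Site 2) (δ : MDir) {du : MDir} (hdu : du ≠ rev δ) :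
    Disjoint (C.BtwN x δ) (C.Q (x + stepVec δ) ∪ C.Hfull (x + stepVec δ) du) := by
  rw [Finset.disjoint_union_right]
  refine ⟨(C.Q_disjoint_BtwN (x + stepVec δ) x δ).symm, Finset.disjoint_left.2 fun t ht ht' => ?_⟩
  rcases Finset.mem_union.1 (C.Hfull_subset_Q_union_EfarN _ du ht') with h | h
  · exact Finset.disjoint_left.1 (C.Q_disjoint_BtwN (x + stepVec δ) x δ).symm ht h
  · have hE := C.EwvN_disjoint_EfarN x hdu
    rw [PCells.EwvN, Finset.disjoint_union_left] at hE
    exact Finset.disjoint_left.1 hE.1 ht h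

end PCells

/-! ## §1 The step device into a staircase span -/

namespace PlanarSkeletonConc

open Literature.Probability.Percolation Literature.Probability.LatticeModels SimpleGraph
open Literature.Barriers.CriticalPhenomena (graphBall graphBall_mono)

variable {V : Type} [DecidableEq V] {G : SimpleGraph V} [G.LocallyFinite] (Φ : PlanarSkeletonConc G)

/-- **The step device, staircase form**: a vertex of depth `≤ n`, footprint in `P` with a `ℤ²`-neighbour of the footprint in `P`, and
`n + 1 ≤ ρ` at both footprints, lies in the staircase span `VStair P ρ`. [this work] -/
theorem mem_VStair_of_zdAdj {w₀ : V} {P : Finset (Site 2)} {ρ : Site 2 → ℕ} {n : ℕ} {y : V} (hy : y ∈ graphBall G w₀ n)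
    (hP : Φ.φ y ∈ P) (hself : ∃ t' ∈ P, (zdGraph 2).Adj (Φ.φ y) t' ∧ n + 1 ≤ ρ t') (hn : n + 1 ≤ ρ (Φ.φ y)) : y ∈ Φ.VStair w₀ P ρ := by
  obtain ⟨t', ht', hadj, hn'⟩ := hself
  obtain ⟨i, σ, rfl⟩ := exists_single_of_zdAdj hadj
  obtain ⟨y', hyy', hφ⟩ := exists_adj_φ_eq (Φ := Φ) y i σ
  refine (mem_vspan_edgesIn_of_adj ?_ ?_ hyy').1
  · exact Φ.mem_stair.2 ⟨hP, graphBall_mono G w₀ (by omega) hy⟩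
  · refine Φ.mem_stair.2 ⟨hφ ▸ ht', ?_⟩
    rw [hφ]
    exact graphBall_mono G w₀ hn' (BoxProdZ2.mem_graphBall_succ_of_adj G hy hyy')

end PlanarSkeletonConc

namespace Skel

open Literature.Probability.Percolation Literature.Probability.LatticeModels SimpleGraph GadgetSystem ProbeHistory HSiteScheme Contour KNCells
open KNCells.KSchA PlanarSkeletonConc KNLevels
open Literature.Barriers.CriticalPhenomena (graphBall mem_graphBall_self graphBall_mono)
open BoxProdZ2 (ConcRadiiG)

variable {V : Type} [DecidableEq V] {G : SimpleGraph V} [G.LocallyFinite] (Φ : PlanarSkeletonConc G)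

/-! ## §2 `Wcor` is a subbox of the fresh-habitat window graph on every fresh region -/

section Generic

variable {A : Type*} {S : KSchA V A} {FD : FaceData V A} {LD : LevelData V A}
variable {h : ProbeHistory V} {e : Site 2 × MDir} {a' : A} {du : MDir}

omit Φ in
/-- **The corridor law `Wcor` is a subbox weighting of the FRESH-HABITAT window graph `winGraphIn G (E_{x,y} ∪ H)` on every region
`Dd ⊆ E_{x,y} ∪ H` inside the habitat `Q_α(y) ∪ E^far_{a'}(y,du)`** — no radius condition: `adj` holds because `Dd ⊆ Ucor ∩ Sx` is fresh,
`outside` because a `Ucor`-vertex adjacent to a fresh vertex lies in `E_{x,y} ∪ H` (`mem_of_adj_fresh`).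
[cite: KozmaNitzan2024, §4 p. 17 (subbox), p. 31] -/
theorem isSubbox_Wcor_hab (hL : LevelGeom G S.Γ FD LD) (hQ : QSepGeom G S.Γ) (hSt : StepsGeom S.Γ FD) (hV : S.Valid₂ G h e)
    (hdu : du ∈ S.onward G h (tgt e)) (ha' : a' ∈ S.Γ.anchSet (S.aOf₁ G h e) (tgt e)) {Dd : Finset V}
    (hDΩ : Dd ⊆ S.Γ.Ewv (S.aOf₁ G h e) e.1 e.2 ∪ FD.Hfull a' (tgt e) du)
    (hDh : Dd ⊆ S.Γ.Q (S.aOf₁ G h e) (tgt e) ∪ S.Γ.Efar a' (tgt e) du) :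
    IsSubbox (winGraphIn G (S.Γ.Ewv (S.aOf₁ G h e) e.1 e.2 ∪ FD.Hfull a' (tgt e) du)) (S.Wcor G FD h e (S.aOf₁ G h e) a' du) S.p Dd := by
  set Ω := S.Γ.Ewv (S.aOf₁ G h e) e.1 e.2 ∪ FD.Hfull a' (tgt e) du with hΩ
  have hΩS : Ω ⊆ S.Sx G h e (S.aOf₁ G h e) a' du := by
    intro v hv
    rcases Finset.mem_union.1 hv with hv | hv
    · exact Finset.mem_union_left _ (Finset.mem_union_right _ hv)
    · rcases Finset.mem_union.1 (hSt.Hfull_subset _ _ _ _ ha' hv) with hv' | hv'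
      · exact Finset.mem_union_left _ (Finset.mem_union_right _ (Finset.mem_union_right _ hv'))
      · exact Finset.mem_union_right _ hv'
  have hΩU : Ω ⊆ S.Ucor G FD h e (S.aOf₁ G h e) a' du := by
    intro v hv
    rcases Finset.mem_union.1 hv with hv | hv
    · exact Finset.mem_union_left _ (Finset.mem_union_right _ hv)
    · exact Finset.mem_union_right _ hv
  exact isSubbox_Wcor_graph (winGraphIn G Ω) (winGraphIn_le G Ω) hV.F_eq (hDΩ.trans hΩS) (hDΩ.trans hΩU)
    (disjoint_Vx_of_fresh hL hQ hV hdu hDh)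
    (fun u hu v hv hadj => (winGraphIn_adj G).2 ⟨hadj, hDΩ hu, hDΩ hv⟩)
    (fun v hv x hx _ hadj => (winGraphIn_adj G).2 ⟨hadj, mem_of_adj_fresh hL hQ hV hdu hDh hv hx hadj, hDΩ hv⟩)

end Generic

/-! ## §3 The corridor residue of the concentric scheme of record -/

section Conc

variable (C : PCells) (t : V) {Λ : ConcRadiiG}

/-- **The fresh habitat of the corridor test** at `(h, e, a', du)`: `E^{α}_{x,y} ∪ H^{a'}_{y,y+du}`, `α = aOf₁`. [cite: KozmaNitzan2024, §4 p. 30] -/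
def habΩ (q : unitInterval) (δc : ℝ) (h : ProbeHistory V) (e : Site 2 × MDir) (a' : ℕ) (du : MDir) : Finset V :=
  (⟨cellGeomSG Φ C t Λ, q, δc⟩ : KSchA V ℕ).Γ.Ewv ((⟨cellGeomSG Φ C t Λ, q, δc⟩ : KSchA V ℕ).aOf₁ G h e) e.1 e.2 ∪
    (faceDataSG Φ C t Λ).Hfull a' (tgt e) du

variable {C t}

/-- A vertex of the fresh habitat with footprint in `C.Q y ∪ C.Hfull y du` lies in the cube span `Q_α(y)` or in the corridor span `H`
(the incoming between-box is planar-disjoint from both). [folklore] -/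
theorem mem_Q_or_Hfull_of_mem_habΩ {q : unitInterval} {δc : ℝ} {h : ProbeHistory V} {e : Site 2 × MDir} {a' : ℕ} {du : MDir}
    (hdu : du ≠ rev e.2) {v : V} (hv : v ∈ habΩ Φ C t (Λ := Λ) q δc h e a' du) (hφ : Φ.φ v ∈ C.Q (tgt e) ∪ C.Hfull (tgt e) du) :
    v ∈ (cellGeomSG Φ C t Λ).Q ((⟨cellGeomSG Φ C t Λ, q, δc⟩ : KSchA V ℕ).aOf₁ G h e) (tgt e) ∨ v ∈ (faceDataSG Φ C t Λ).Hfull a' (tgt e) du := by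
  rcases Finset.mem_union.1 hv with hv | hv
  · rcases Finset.mem_union.1 hv with hv | hv
    · -- the between-box: planar contradiction
      have hB : Φ.φ v ∈ C.BtwN e.1 e.2 := φ_mem_of_mem_VWin hv
      exact absurd hφ (Finset.disjoint_left.1 (C.BtwN_disjoint_Q_union_Hfull e.1 e.2 hdu) hB)
    · exact Or.inl hv
  · exact Or.inr hv

variable (hΛ : WFS C Λ) (hφ : Φ.φ t = 0)
include hΛ hφ

/-- **THE CORRIDOR RESIDUE OF THE SCHEME OF RECORD, HABITAT FORM** (generic design (D), (C)): `Skel.ReachOblAtH` from a habitat chain over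
the fresh habitat `Ω = E^{α}_{x,y} ∪ H^{a'}_{y,y+du}`, two depth-room facts of the schedule, and — as hypotheses — the per-step kit clauses,
the rim excess and the count. [cite: KozmaNitzan2024, §4 Lemma 12 (pp. 23–25), p. 30 (Step IV), p. 31] -/
theorem reachOblAtH_concSG [Countable V] {q : unitInterval} {δc : ℝ} {h : ProbeHistory V} {e : Site 2 × MDir}
    (hV : (⟨cellGeomSG Φ C t Λ, q, δc⟩ : KSchA V ℕ).Valid₂ G h e) {a' : ℕ}
    (ha' : a' ∈ ({(⟨cellGeomSG Φ C t Λ, q, δc⟩ : KSchA V ℕ).aOf₁ G h e, (⟨cellGeomSG Φ C t Λ, q, δc⟩ : KSchA V ℕ).aOf₁ G h e + 1} : Finset ℕ))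
    {du : MDir} (hdu : du ∈ (⟨cellGeomSG Φ C t Λ, q, δc⟩ : KSchA V ℕ).onward G h (tgt e)) (hdur : du ≠ rev e.2)
    (P : HabChainData V) (hPΩ : P.Ω = habΩ Φ C t (Λ := Λ) q δc h e a' du) (hPC : P.C = C) (hPx : P.x = tgt e) (hPdu : P.du = du)
    (hProot : P.root = t)
    (hPS : P.Sfin = (⟨cellGeomSG Φ C t Λ, q, δc⟩ : KSchA V ℕ).Sx G h e ((⟨cellGeomSG Φ C t Λ, q, δc⟩ : KSchA V ℕ).aOf₁ G h e) a' du)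
    (hRim : ∀ i, P.Rim i ⊆ P.stepD Φ i)
    (hr : C.r = 4 * P.t) (hR : 100 * P.R' ≤ P.t) (hRl : P.Rlev + 1 ≤ P.R') (hj : P.j₁ ≤ P.Rlev)
    -- depth room: a vertex of the fresh habitat over every planar point of `Q_y ∪ H`; the last target enters `M^{a'}_{y+du}`
    (hcolQ : 20 * C.r * (((tgt e) 0).natAbs + ((tgt e) 1).natAbs) + 44 * C.r + 1 ≤
      Λ.rQ ((⟨cellGeomSG Φ C t Λ, q, δc⟩ : KSchA V ℕ).aOf₁ G h e) (tgt e))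
    (hcolρ : ∀ ℓ, 20 * C.r * (((tgt e) 0).natAbs + ((tgt e) 1).natAbs) + 44 * C.r + 1 ≤ Λ.ρ a' (tgt e) du ℓ)
    (hρM : ∀ ℓ, Λ.ρ a' (tgt e) du ℓ + 1 ≤ Λ.rM a' (tgt e + stepVec du))
    -- the analytic inputs
    {Δ' : ℕ} {δ η : ℝ} (hcount : 1 / (1 - (q : ℝ)) ^ (Δ' * P.N) ≤ δ * ((Finset.Icc P.j₀ P.j₁).card : ℝ))
    (hkits : ∀ i ≤ ChainPlanar.Sched.nLast, ∀ j ∈ Finset.Icc P.j₀ P.j₁,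
      ∃ (σ : KNLevels.SData V) (Sz : Finset V),
      KNLevels.SHyp (winLDataIn Φ P.Ω (P.lo i) (P.hi i) P.root P.Sfin) j σ ∧ σ.N ≤ P.N ∧
      (1 - (q : ℝ) ^ σ.sB) ^ σ.k ≤ δ ∧ Sz ⊆ (winLDataIn Φ P.Ω (P.lo i) (P.hi i) P.root P.Sfin).X j ∧ Sz ⊆ P.stepD Φ i ∧
      (∀ x ∈ σ.K, ∀ e' ∈ σ.seed x, e' ∉ wireSet (↑Sz : Set V)) ∧ (∀ x ∈ σ.K, σ.face x ⊆ Sz) ∧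
      (∀ x ∈ σ.K, 1 - 3 * δ ≤ (prodBernoulli ((⟨cellGeomSG Φ C t Λ, q, δc⟩ : KSchA V ℕ).Wcor G (faceDataSG Φ C t Λ) h e
          ((⟨cellGeomSG Φ C t Λ, q, δc⟩ : KSchA V ℕ).aOf₁ G h e) a' du)).real {ω | ∃ u ∈ σ.face x,
        1 - δ < (prodBernoulli (pinW ((⟨cellGeomSG Φ C t Λ, q, δc⟩ : KSchA V ℕ).Wcor G (faceDataSG Φ C t Λ) h e
          ((⟨cellGeomSG Φ C t Λ, q, δc⟩ : KSchA V ℕ).aOf₁ G h e) a' du) (wireSet (↑Sz : Set V)) ω)).real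
          (⋃ t' ∈ P.tgtE Φ i, openConnIn (↑(P.stepD Φ i) : Set V) u t')}))
    (hη : η ≤ δ / 2)
    (hexc : ∀ i ≤ ChainPlanar.Sched.nLast, (prodBernoulli ((⟨cellGeomSG Φ C t Λ, q, δc⟩ : KSchA V ℕ).Wcor G (faceDataSG Φ C t Λ) h e
        ((⟨cellGeomSG Φ C t Λ, q, δc⟩ : KSchA V ℕ).aOf₁ G h e) a' du)).real (⋃ t' ∈ P.Rim i, openConn t t') ≤ η) :
    ReachOblAtH G (⟨cellGeomSG Φ C t Λ, q, δc⟩ : KSchA V ℕ) (faceDataSG Φ C t Λ) Δ' δ h e a' du := by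
  -- abbreviations
  set S : KSchA V ℕ := ⟨cellGeomSG Φ C t Λ, q, δc⟩ with hSdef
  set FD := faceDataSG Φ C t Λ with hFDdef
  set α := S.aOf₁ G h e with hαdef
  set y := tgt e with hydef
  have hroot' : S.Γ.root = t := rfl
  have hL := levelGeomSG Φ C t hΛ (Λ := Λ)
  have hQ : QSepGeom G S.Γ := qSepGeomSG Φ C t (Λ := Λ)
  have hSt := stepsGeomSG Φ C t hΛ (Λ := Λ)
  have hEx := exitGeomSG Φ C t hΛ (Λ := Λ)
  have ha'' : a' ∈ S.Γ.anchSet α y := ha'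
  have hle : ∀ i : Fin (ChainPlanar.Sched.nLast + 1), (i : ℕ) ≤ ChainPlanar.Sched.nLast := fun i => Nat.lt_succ_iff.1 i.2
  -- every region is inside the fresh habitat and inside the habitat `Q_α(y) ∪ E^far`
  have hDΩ : ∀ i, P.stepD Φ i ⊆ S.Γ.Ewv α e.1 e.2 ∪ FD.Hfull a' y du := fun i => by
    rw [← show habΩ Φ C t (Λ := Λ) q δc h e a' du = S.Γ.Ewv α e.1 e.2 ∪ FD.Hfull a' y du from rfl, ← hPΩ]
    exact P.stepD_subset_Ω Φ i
  have hDh : ∀ i ≤ ChainPlanar.Sched.nLast, P.stepD Φ i ⊆ S.Γ.Q α y ∪ S.Γ.Efar a' y du := by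
    intro i hi v hv
    have hvΩ : v ∈ habΩ Φ C t (Λ := Λ) q δc h e a' du := hPΩ ▸ P.stepD_subset_Ω Φ i hv
    have hvφ : Φ.φ v ∈ C.Q y ∪ C.Hfull y du := by
      have := P.stepD_subset Φ (hPC.symm ▸ hr) hR hi hv
      rw [hPC, hPx, hPdu] at this
      exact ((Φ.mem_WinIn).1 this).2
    rcases mem_Q_or_Hfull_of_mem_habΩ Φ hdur hvΩ hvφ with hvQ | hvH
    · exact Finset.mem_union_left _ hvQ
    · exact hSt.Hfull_subset _ _ _ _ ha'' hvH
  -- the targets are nonempty: a vertex of the fresh habitat above every core point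
  have hTne : ∀ i ≤ ChainPlanar.Sched.nLast, (P.tgtT Φ i).Nonempty := by
    intro i hi
    obtain ⟨x₀, hx₀⟩ := P.pcore_nonempty hR (i := i + 1) (by omega)
    have hx₀' : x₀ ∈ C.Q y ∪ C.Hfull y du := by
      have := ChainPlanar.Sched.region_subset_Q_union_Hfull (hPC.symm ▸ hr) hR hi
        (ChainPlanar.Sched.core_succ_subset_region (Literature.Probability.Percolation.KozmaNitzan.Cells.sgOf_sign P.du) _ hR hi hx₀)
      rw [hPC, hPx, hPdu] at this
      exact this
    obtain ⟨g, hg, hφg⟩ := PlanarSkeleton.exists_mem_graphBall_φ_eq Φ.toPlanarSkeleton Φ.step t x₀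
    simp only [hφ, Pi.zero_apply, sub_zero] at hg
    have hnorm := C.norm_le_of_mem_Q_union_Hfull y du hx₀'
    refine P.tgtT_nonempty_of Φ (v := g) ?_ (by rw [show Φ.φ g = x₀ from hφg]; exact hx₀)
    have hn1 : (x₀ 0).natAbs + (x₀ 1).natAbs + 1 ≤ 20 * C.r * ((y 0).natAbs + (y 1).natAbs) + 44 * C.r + 1 := by omega
    rcases Finset.mem_union.1 hx₀' with hxQ | hxH
    · -- over the cube: into the span `Q_α(y)` by the step device
      have hxQ' : Φ.φ g ∈ C.Q y := by rw [hφg]; exact hxQ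
      have hgQ : g ∈ Φ.VWin t (C.Q y) (Λ.rQ α y) := Φ.mem_VWin_of_zdAdj hg (hn1.trans hcolQ) hxQ' (C.exists_adj_of_mem_Q _ hxQ')
      rw [hPΩ]
      exact Finset.mem_union_left _ (Finset.mem_union_right _ hgQ)
    · -- over the corridor: into the staircase span `H` by the step device
      have hxH' : Φ.φ g ∈ C.Hfull y du := by rw [hφg]; exact hxH
      obtain ⟨t', ht', hadj⟩ := C.exists_adj_of_mem_Hfull y du hxH'
      have h1 : (x₀ 0).natAbs + (x₀ 1).natAbs + 1 ≤ prof C Λ a' y du t' := by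
        unfold prof; exact hn1.trans (hcolρ _)
      have h2 : (x₀ 0).natAbs + (x₀ 1).natAbs + 1 ≤ prof C Λ a' y du (Φ.φ g) := by
        unfold prof; exact hn1.trans (hcolρ _)
      have hgH : g ∈ Φ.VStair t (C.Hfull y du) (prof C Λ a' y du) := Φ.mem_VStair_of_zdAdj hg hxH' ⟨t', ht', hadj, h1⟩ h2
      rw [hPΩ]
      exact Finset.mem_union_right _ hgH
  refine ⟨ChainPlanar.Sched.nLast, nLast_le_nmaxC, P.Ω, fun i => P.stepH Φ i, fun i => P.tgtT Φ i, η, fun i => ?_, fun i => ?_,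
    fun i => P.tgtT_subset_tgtE Φ i, fun i => ?_, hη, fun i => ?_, ?_, ?_⟩
  · rw [HabChainData.stepH_o, hProot]; exact hroot'.symm
  · -- the true targets link the chain
    show P.tgtT Φ (Fin.castSucc i) ⊆ (P.stepH Φ i.succ).L.X 0
    have : ((i.succ : Fin (ChainPlanar.Sched.nLast + 1)) : ℕ) = (Fin.castSucc i : ℕ) + 1 := by simp
    rw [show P.stepH Φ (i.succ : ℕ) = P.stepH Φ ((Fin.castSucc i : ℕ) + 1) by rw [this]]
    exact P.tgtT_subset_X_zero_succ Φ _
  · -- the kits of step `i`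
    refine HabChainData.kitsAt_stepH Φ hR hRl hRim (hle i) (hTne i (hle i)) ?_ ?_ ?_ ?_ ?_ hj hcount (hkits i (hle i))
    · rw [hPΩ]; exact isSubbox_Wcor_hab hL hQ hSt hV hdu ha'' (hDΩ i) (hDh i (hle i))
    · rw [hPS]; exact finSupp_Wcor
    · -- regions inside the support `Sx`
      intro v hv
      rw [hPS]
      rcases Finset.mem_union.1 (hDh i (hle i) hv) with hv' | hv'
      · exact Finset.mem_union_left _ (Finset.mem_union_right _ (Finset.mem_union_right _ hv'))
      · exact Finset.mem_union_right _ hv'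
    · rw [hProot]; exact root_not_mem_of_fresh hL hQ hV hdu (hDh i (hle i))
    · rw [hProot, hPS]; exact Finset.mem_union_left _ (Finset.mem_union_left _ hV.root_mem)
  · -- the rim excess
    refine le_trans (measureReal_mono ?_ (measure_ne_top _ _)) (hexc i (hle i))
    intro ω hω
    simp only [Set.mem_iUnion, exists_prop] at hω ⊢
    obtain ⟨t', ht', hωt⟩ := hω
    exact ⟨t', P.tgtE_sdiff_subset Φ i ht', hωt⟩
  · -- the arrival cube `M_α(y) ⊆ Q_α(y) ⊆ Ω`, footprint in `C.M y`
    show S.Γ.M α y ⊆ (P.stepH Φ ((0 : Fin (ChainPlanar.Sched.nLast + 1)) : ℕ)).L.X 0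
    refine subset_trans ?_ (HabChainData.cube_subset_X_zero Φ (hPC.symm ▸ hr) hR subset_rfl)
    intro v hv
    rw [hPΩ, hPC, hPx]
    refine (Φ.mem_WinIn).2 ⟨Finset.mem_union_left _ (Finset.mem_union_right _ (hEx.M_subset_Q α y hv)), ?_⟩
    change v ∈ Φ.VWin t (C.M y) (Λ.rM α y) at hv
    exact φ_mem_of_mem_VWin hv
  · -- the last true target enters `M^{a'}_{y+du}` by the step device
    show P.tgtT Φ ((Fin.last ChainPlanar.Sched.nLast : Fin _) : ℕ) ⊆ S.Γ.M a' (y + stepVec du)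
    rw [Fin.val_last]
    intro v hv
    have hv' := P.tgtT_last_subset Φ (hPC.symm ▸ hr) hR hv
    rw [hPC, hPx, hPdu] at hv'
    obtain ⟨hvΩ, hvφ⟩ := (Φ.mem_WinIn).1 hv'
    rw [hPΩ] at hvΩ
    obtain ⟨hvM, hvH⟩ := Finset.mem_inter.1 hvφ
    have hcase := mem_Q_or_Hfull_of_mem_habΩ Φ hdur hvΩ (Finset.mem_union_right _ hvH)
    change v ∈ Φ.VWin t (C.M (y + stepVec du)) (Λ.rM a' (y + stepVec du))
    rcases hcase with hvQ | hvHs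
    · -- footprint in `C.Q y` and in `C.M (y+du) ⊆ C.Q (y+du)`: impossible
      have h1 : Φ.φ v ∈ C.Q y := φ_mem_of_mem_VWin hvQ
      have h2 : Φ.φ v ∈ C.Q (y + stepVec du) := C.M_subset_Q _ hvM
      have hne : y ≠ y + stepVec du := fun h' => by
        have h3 := congrArg (fun z => z du.1) h'
        simp only [Pi.add_apply, Literature.Probability.Percolation.KozmaNitzan.Cells.stepVec_apply_fst] at h3
        rcases Literature.Probability.Percolation.KozmaNitzan.Cells.sgOf_sign du with hs | hs <;> rw [hs] at h3 <;> linarith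
      exact absurd h2 (Finset.disjoint_left.1 (C.Q_disjoint_Q hne) h1)
    · obtain ⟨_, hd⟩ := mem_of_mem_VStair hvHs
      exact Φ.mem_VWin_of_zdAdj hd (hρM _) hvM (C.exists_adj_of_mem_M _ hvM)

end Conc

end Skel

end Transplant

end Summit.CriticalPhenomena.PercolationContinuityZ3.Theorems

end
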